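import Summits.HodgeConjecture.HodgeConjecture.Theorems.Ring2AbelianAllAndreSpreadVerdier
import Summits.HodgeConjecture.HodgeConjecture.Theorems.Ring2AbelianAllAndreTransportLatticeCM
import Summits.HodgeConjecture.HodgeConjecture.Theorems.AnchorTransportVariationalHodgeCurveThickness
import Literature.AlgebraicGeometry.HodgeTheory.AlgebraicityLocusIUnionClosedProofs
import Mathlib.LinearAlgebra.Countable
import HarnessLib

/-!
# Ring 2 · sub-cell AbelianAll (ALL ABELIAN VARIETIES), André axis, part XXXI-a — SPORADIC ALGEBRAIC CLASSES:
# the lift `(L)_t(p)` HOLDS AT ALL BUT COUNTABLY MANY FIBRES of every smooth projective family over a smooth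
# projective curve (granted Verdier 1976 only), and at a given fibre it says exactly "no class of the total space is
# algebraic on `𝒳_t` but on only countably many fibres" (part XXXI-b: the nodes (2), (4) are FACT-FREE equivalent to
# their "uncountably many fibres" weakenings, `HC_AV ⟺ HC_CM ∧ (4_ℵ)` modulo Lemme 6.3.1 alone, the per-pencil rung)

HONEST FRAMING (page 1, verbatim): **research route, not a corollary; conditional on HC_CM plus one named
minimal statement.** Cell line: research route conditional on HC_CM; not a corollary; Q11.4-sentence-2 already
refuted in dim ≥ 3. Nothing in this file proves a case of the Hodge conjecture for an abelian variety. `HC_CM`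
(`Theses.RankFourFaces.CMAbelianHodge`) and `HC_AV` (`Theses.PadicSemiregularLift.HodgeAbelianVarieties`) are
BINDERS wherever they occur; `hGT` = Verdier's generic local triviality and `h₂₁` = André's Lemme 6.3.1 are
NAMED-FACT BINDERS; the reduction item `CMToAbelian` (stmt-HodgeConjecture-16267) is NOT closed here; the cell's
`B_min` of record (N104) is untouched; NO node is born (0 `def`), nothing is claimed minimal.

## What this part does (brief (ii)/(iii): "identify precisely where the minimal statement has content")

Write `(L)_t(p)` for the lattice form of the André-axis lift at the fibre `t` in degree `2p` (part XVII-b):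
`(j_t^*)⁻¹ Nᵖ(𝒳_t) ≤ Nᵖ(𝒳) ⊔ ker j_t^*`. Call a class `W ∈ H²ᵖ(𝒳(ℂ); ℂ)` SPORADIC AT `t` if `W|_{𝒳_t}` is algebraic
but `{s | W|_{𝒳_s} algebraic}` is countable. The tree PROVES (Charles–Schnell Prop. 11.3.11 / relative Hilbert
schemes, `charlesSchnell_algebraicityLocus_iUnion_closed_holds`, NO named fact) that the algebraicity locus of a
global class is a countable union of Zariski-closed sets of the base; over a CURVE each is finite or everything, so:

* §1–§2 (fact-free) **DICHOTOMY**: on a smooth projective family over a smooth projective curve the algebraicity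
  locus of any `W` is COUNTABLE or ALL of `S(ℂ)` (`algebraicityLocus_countable_or_forall`); algebraic on uncountably
  many fibres ⟹ algebraic on every fibre (`forall_mem_algebraicClasses_of_not_countable`).
* §3 [Verdier] **lift from uncountably many fibres** (`exists_algebraic_lift_of_not_countable_of_verdier`).
* §4 [Verdier] **`(L)_t(p)` HOLDS FOR ALL `t` OUTSIDE A COUNTABLE SUBSET OF `S(ℂ)`, all `p` at once**
  (`exists_countable_forall_comap_le_sup_of_verdier`): the exceptional set is the union of the countable
  algebraicity loci of the countably many RATIONAL classes of `𝒳` that have one (part XVII-b's reduction to rational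
  classes). So the André-axis `B_min` is a statement about countably many fibres of each pencil — and the CM fibres,
  where it is read, are countably many too: nothing generic is being asked.
* §5 **POINTWISE EXACTNESS**: `(L)_t(p)` ⟺ no class is sporadic at `t` ⟺ every class algebraic on `𝒳_t` is
  algebraic on every fibre (`comap_le_sup_iff_forall_not_countable_of_verdier`, `…_iff_transport_…`; ⟹ fact-free).
* Part XXXI-b (`Ring2AbelianAllAndreSporadicClassesNodes`): the NODES (4) ⟺ (4_ℵ), (2) ⟺ (2_ℵ) fact-free,
  `HC_AV ⟺ HC_CM ∧ (4_ℵ)` modulo Lemme 6.3.1 only, (L) ⟺ (4_ℵ) / (L∀) ⟺ (2_ℵ) modulo Verdier, and the PER-PENCIL RUNG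
  "`HC` in degree `2p` at uncountably many members of ONE compact pencil ⟹ `(L)_t(p)` at every `t`".

READING (RING2-MAP §AbelianAll (ab-andre-2, gen 23)). The `B_min` of the André axis at a CM point `t` fails only
through a SPORADIC invariant algebraic class at `t`; sporadic classes live on countably many fibres of any pencil;
and `(L)_t(p)` is implied by the Hodge conjecture in degree `2p` for a very general member of the pencil. On the
pencils Lemme 6.3.1 attaches to an abelian variety `A` the very general member carries the same invariant Hodge
classes as the CM fibre, so this is WHERE the statement has content (the exceptional habitats), not a way round it.
Compare seat b02's (U) `OneParameterAbelianSchemeVHCUncountable` (affine bases with a section, modulo a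
quasi-projectivity residual): §6 is the compact-pencil, residual-free, `HC_CM`-explicit form on THIS axis's nodes.

EDGE LABELS: §1, §2, §5 (⟹) fact-free; §3, §4, §5 (⟸) K[Verdier] (`hGT` a hypothesis). No `def`, no `sorry`;
axioms standard.

References: CharlesSchnell2014Notes (Prop. 11.3.11 (proof), Conj. 11.3.1, Cor. 11.3.6); VoisinHodgeII2003 (§3.3.1,
§7.3.2, §10.2.1 proof of Thm. 10.19); Verdier1976 (Cor. (5.1)); Andre1996Motifs (§5.1 (A3)–(A4) p. 25, §6.3 Lemme
6.3.1 p. 31, a) and Remarque 2 p. 33); Milne2020HodgeClassesAV (Prop. 1); Grothendieck1966 (footnote 13);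
GrothendieckTopology1969 (§1); SerreGAGA1956 (§2); Hartshorne1977 (II Thm. 4.9, Ex. 3.13).
-/

noncomputable section

set_option linter.dupNamespace false

namespace Summit.HodgeConjecture.HodgeConjecture.Ring2.AbelianAll

open CategoryTheory AlgebraicGeometry
open Literature.AlgebraicGeometry Literature.AlgebraicGeometry.Motives
open Literature.AlgebraicGeometry.HodgeTheory
open Literature.AlgebraicGeometry.Andre1996 (andre1996_cmAnchoredPencil)
open Literature.AlgebraicGeometry.Deligne1982 (cmLocus)
open Summit.HodgeConjecture.HodgeConjecture
open Summit.HodgeConjecture.HodgeConjecture.Theses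
open Summit.HodgeConjecture.HodgeConjecture.Ring2.Deform (CompactAbelianPencilVHC HC_CM_of_HC_AV)

variable {𝒳 S : SchemeOver ℂ}

/-! ## §1 Carriers: complex points over closed subsets of a smooth projective curve -/

/-- **Only finitely many complex points of a smooth projective curve lie over a proper Zariski-closed subset**:
`S` is an irreducible Noetherian scheme of Krull dimension `1` (proper over `ℂ`, smooth of relative dimension
`1`), so a proper closed subset is finite (`Theorems.finite_of_isClosed_ne_univ_of_topologicalKrullDim_le_one`),
and complex points are determined by their closed points (`Theorems.finite_setOf_pt_mem`).
[cite: Hartshorne1977, Ch. II Thm. 4.9 and Ex. 3.13] -/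
theorem finite_setOf_pt_mem_of_curve (hS : IsSmoothProjective 1 S) {Z : Set S.left} (hZ : IsClosed Z)
    (hne : Z ≠ Set.univ) : {t : ComplexPoints S | t.pt ∈ Z}.Finite := by
  haveI : SmoothOfRelativeDimension 1 S.hom := hS.smoothOfRelativeDimension
  haveI : Smooth S.hom := SmoothOfRelativeDimension.smooth 1 S.hom
  haveI : LocallyOfFiniteType S.hom := inferInstance
  haveI : IrreducibleSpace S.left := hS.irreducibleSpace
  haveI : IsProper S.hom := IsSmoothProjective.isProper_holds hS
  haveI : IsLocallyNoetherian S.left := LocallyOfFiniteType.isLocallyNoetherian S.hom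
  haveI : CompactSpace S.left := QuasiCompact.compactSpace_of_compactSpace S.hom
  haveI : IsNoetherian S.left := {}
  have hdim : topologicalKrullDim S.left ≤ 1 :=
    (topologicalKrullDim_eq_of_smoothOfRelativeDimension S.hom 1).le
  exact Theorems.finite_setOf_pt_mem
    (Theorems.finite_of_isClosed_ne_univ_of_topologicalKrullDim_le_one hdim hZ hne)

/-- **Dichotomy for countable unions of closed point-sets of a smooth projective curve**: the set of complex
points lying over `⋃ⱼ Zⱼ` (`Zⱼ ⊆ S` Zariski-closed) is COUNTABLE, or it is ALL of `S(ℂ)` (some `Zⱼ = S`).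
[cite: Hartshorne1977, Ch. II Ex. 3.13] -/
theorem countable_or_eq_univ_of_iUnion_isClosed (hS : IsSmoothProjective 1 S) (Z : ℕ → Set S.left)
    (hZ : ∀ j, IsClosed (Z j)) :
    (⋃ j, {t : ComplexPoints S | t.pt ∈ Z j}).Countable ∨ (⋃ j, {t : ComplexPoints S | t.pt ∈ Z j}) = Set.univ := by
  by_cases huniv : ∃ j, Z j = Set.univ
  · obtain ⟨j, hj⟩ := huniv
    refine Or.inr (Set.eq_univ_of_forall fun t ↦ Set.mem_iUnion.2 ⟨j, ?_⟩)
    simp only [Set.mem_setOf_eq, hj, Set.mem_univ]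
  · push Not at huniv
    exact Or.inl (Set.countable_iUnion fun j ↦ (finite_setOf_pt_mem_of_curve hS (hZ j) (huniv j)).countable)

/-- **The complex points of a smooth projective curve are uncountable** (as soon as there is one): `S(ℂ)` is a
real surface (`Theorems.not_countable_complexPoints`). [cite: SerreGAGA1956, §2 n°5 Prop. 2 and n°6] -/
theorem not_countable_univ_of_curve (hS : IsSmoothProjective 1 S) (t : ComplexPoints S) :
    ¬ (Set.univ : Set (ComplexPoints S)).Countable := by
  haveI : SmoothOfRelativeDimension 1 S.hom := hS.smoothOfRelativeDimension
  haveI : Smooth S.hom := SmoothOfRelativeDimension.smooth 1 S.hom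
  haveI : LocallyOfFiniteType S.hom := inferInstance
  haveI : Nonempty (ComplexPoints S) := ⟨t⟩
  exact Theorems.not_countable_complexPoints S (n := 1) le_rfl

/-- A set of complex points of a smooth projective curve containing every point is uncountable; contrapositively a
COUNTABLE set of complex points misses some point. [cite: SerreGAGA1956, §2 n°5 Prop. 2 and n°6] -/
theorem not_countable_of_forall_mem_of_curve (hS : IsSmoothProjective 1 S) (t : ComplexPoints S)
    {Λ : Set (ComplexPoints S)} (hΛ : ∀ s, s ∈ Λ) : ¬ Λ.Countable := by
  rw [Set.eq_univ_of_forall hΛ]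
  exact not_countable_univ_of_curve hS t

/-! ## §2 The algebraicity locus over a curve: countable, or everything (no named fact) -/

/-- **DICHOTOMY FOR THE ALGEBRAICITY LOCUS OVER A CURVE (fact-free).** Let `S` be a smooth projective curve,
`f : 𝒳 ⟶ S` a smooth projective family of relative dimension `d` with `𝒳` quasi-projective, `W ∈ H²ᵖ(𝒳(ℂ); ℂ)`.
Then the set of `t ∈ S(ℂ)` with `W|_{𝒳_t}` algebraic is COUNTABLE, or it is all of `S(ℂ)`. The locus is a
countable union of complex-point sets of Zariski-closed subsets of `S` by the tree's PROVED
`charlesSchnell_algebraicityLocus_iUnion_closed_holds` (relative Hilbert schemes; Mumford's curve lemma), and §1.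
[cite: CharlesSchnell2014Notes, Prop. 11.3.11 (proof)] [cite: VoisinHodgeII2003, §3.3.1 and §7.3.2] -/
theorem algebraicityLocus_countable_or_forall (hS : IsSmoothProjective 1 S) (h𝒳 : IsQuasiProjectiveOver 𝒳)
    {d : ℕ} {f : 𝒳 ⟶ S} (hf : IsSmoothProjectiveFamily f d) {p : ℕ} (W : complexBetti 𝒳 (2 * p)) :
    {t : ComplexPoints S | complexBetti.map (fiberι f t) (2 * p) W ∈ algebraicClasses (fiberOver f t) p}.Countable ∨
      ∀ t : ComplexPoints S, complexBetti.map (fiberι f t) (2 * p) W ∈ algebraicClasses (fiberOver f t) p := by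
  haveI : SmoothOfRelativeDimension 1 S.hom := hS.smoothOfRelativeDimension
  have hSsm : Smooth S.hom := SmoothOfRelativeDimension.smooth 1 S.hom
  have hSqp : IsQuasiProjectiveOver S := IsQuasiProjectiveOver.of_isProjectiveOver hS.isProjectiveOver
  obtain ⟨Z, hZc, hZ⟩ := charlesSchnell_algebraicityLocus_iUnion_closed_holds f d p h𝒳 hSqp hSsm hf W
  rcases countable_or_eq_univ_of_iUnion_isClosed hS Z hZc with hc | hu
  · exact Or.inl (hZ ▸ hc)
  · refine Or.inr fun t ↦ ?_
    have ht : t ∈ ⋃ j, {t : ComplexPoints S | t.pt ∈ Z j} := hu ▸ Set.mem_univ t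
    rw [← hZ] at ht
    exact ht

/-- **ALGEBRAIC ON UNCOUNTABLY MANY FIBRES ⟹ ALGEBRAIC ON EVERY FIBRE (fact-free)**, over a smooth projective curve.
[cite: CharlesSchnell2014Notes, Prop. 11.3.11 (proof)] [cite: VoisinHodgeII2003, §7.3.2, proof of Thm. 7.19] -/
theorem forall_mem_algebraicClasses_of_not_countable (hS : IsSmoothProjective 1 S) (h𝒳 : IsQuasiProjectiveOver 𝒳)
    {d : ℕ} {f : 𝒳 ⟶ S} (hf : IsSmoothProjectiveFamily f d) {p : ℕ} (W : complexBetti 𝒳 (2 * p))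
    (hW : ¬ {t : ComplexPoints S |
      complexBetti.map (fiberι f t) (2 * p) W ∈ algebraicClasses (fiberOver f t) p}.Countable)
    (t : ComplexPoints S) : complexBetti.map (fiberι f t) (2 * p) W ∈ algebraicClasses (fiberOver f t) p :=
  ((algebraicityLocus_countable_or_forall hS h𝒳 hf W).resolve_left hW) t

/-- The same on a compact pencil of abelian `d`-folds (total space smooth projective, hence quasi-projective).
[cite: CharlesSchnell2014Notes, Prop. 11.3.11 (proof)] -/
theorem forall_mem_algebraicClasses_of_not_countable' {d : ℕ} {f : 𝒳 ⟶ S} (hf : IsCompactAbelianPencil f d)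
    {p : ℕ} (W : complexBetti 𝒳 (2 * p))
    (hW : ¬ {t : ComplexPoints S |
      complexBetti.map (fiberι f t) (2 * p) W ∈ algebraicClasses (fiberOver f t) p}.Countable)
    (t : ComplexPoints S) : complexBetti.map (fiberι f t) (2 * p) W ∈ algebraicClasses (fiberOver f t) p :=
  forall_mem_algebraicClasses_of_not_countable hf.isSmoothProjective_base
    (IsQuasiProjectiveOver.of_isProjectiveOver hf.isSmoothProjective_total.isProjectiveOver)
    hf.isSmoothProjectiveFamily W hW t

/-- **Algebraic on every fibre ⟹ the algebraicity locus is uncountable** (it is `S(ℂ)`, a surface); so over a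
curve "algebraic on uncountably many fibres" and "algebraic on all fibres" are the SAME condition.
[cite: SerreGAGA1956, §2 n°5 Prop. 2 and n°6] -/
theorem not_countable_algebraicityLocus_iff_forall (hS : IsSmoothProjective 1 S) (h𝒳 : IsQuasiProjectiveOver 𝒳)
    {d : ℕ} {f : 𝒳 ⟶ S} (hf : IsSmoothProjectiveFamily f d) {p : ℕ} (W : complexBetti 𝒳 (2 * p))
    (t₀ : ComplexPoints S) :
    ¬ {t : ComplexPoints S | complexBetti.map (fiberι f t) (2 * p) W ∈ algebraicClasses (fiberOver f t) p}.Countable ↔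
      ∀ t : ComplexPoints S, complexBetti.map (fiberι f t) (2 * p) W ∈ algebraicClasses (fiberOver f t) p :=
  ⟨fun h ↦ forall_mem_algebraicClasses_of_not_countable hS h𝒳 hf W h,
    fun h ↦ not_countable_of_forall_mem_of_curve hS t₀ (Λ := {t : ComplexPoints S |
      complexBetti.map (fiberι f t) (2 * p) W ∈ algebraicClasses (fiberOver f t) p}) h⟩

/-! ## §3 The lift from uncountably many algebraic fibres, granted Verdier -/

/-- **LIFT FROM UNCOUNTABLY MANY FIBRES, GRANTED VERDIER.** `S` a smooth projective curve, `𝒳` smooth projective of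
dimension `d + 1`, `f : 𝒳 ⟶ S` a smooth projective family of relative dimension `d`, `W ∈ H²ᵖ(𝒳(ℂ); ℂ)` algebraic on
the fibres over an UNCOUNTABLE set of complex points. Then some algebraic `η ∈ Nᵖ H²ᵖ(𝒳(ℂ); ℂ)` has
`η|_{𝒳_s} = W|_{𝒳_s}` for EVERY `s` (§2, then part XX-a's `exists_algebraic_lift_of_verdier`).
[cite: Verdier1976, Cor. (5.1)] [cite: VoisinHodgeII2003, §10.2.1 (proof of Thm. 10.19)]
[cite: CharlesSchnell2014Notes, Prop. 11.3.11 (proof)] -/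
theorem exists_algebraic_lift_of_not_countable_of_verdier (hGT : Verdier1976_genericLocalTriviality) {d : ℕ}
    {f : 𝒳 ⟶ S} (hS : IsSmoothProjective 1 S) (h𝒳 : IsSmoothProjective (d + 1) 𝒳)
    (hf : IsSmoothProjectiveFamily f d) {p : ℕ} (W : complexBetti 𝒳 (2 * p))
    (hW : ¬ {t : ComplexPoints S |
      complexBetti.map (fiberι f t) (2 * p) W ∈ algebraicClasses (fiberOver f t) p}.Countable) :
    ∃ η ∈ algebraicClasses 𝒳 p, ∀ s : ComplexPoints S,
      complexBetti.map (fiberι f s) (2 * p) η = complexBetti.map (fiberι f s) (2 * p) W :=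
  exists_algebraic_lift_of_verdier hGT hS h𝒳 hf W
    (forall_mem_algebraicClasses_of_not_countable hS
      (IsQuasiProjectiveOver.of_isProjectiveOver h𝒳.isProjectiveOver) hf W hW)

/-- The same on a compact pencil of abelian `d`-folds. [cite: Verdier1976, Cor. (5.1)]
[cite: CharlesSchnell2014Notes, Prop. 11.3.11 (proof)] -/
theorem exists_algebraic_lift_of_not_countable_of_verdier' (hGT : Verdier1976_genericLocalTriviality) {d : ℕ}
    {f : 𝒳 ⟶ S} (hf : IsCompactAbelianPencil f d) {p : ℕ} (W : complexBetti 𝒳 (2 * p))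
    (hW : ¬ {t : ComplexPoints S |
      complexBetti.map (fiberι f t) (2 * p) W ∈ algebraicClasses (fiberOver f t) p}.Countable) :
    ∃ η ∈ algebraicClasses 𝒳 p, ∀ s : ComplexPoints S,
      complexBetti.map (fiberι f s) (2 * p) η = complexBetti.map (fiberι f s) (2 * p) W :=
  exists_algebraic_lift_of_not_countable_of_verdier hGT hf.isSmoothProjective_base hf.isSmoothProjective_total
    hf.isSmoothProjectiveFamily W hW

/-! ## §4 `(L)_t(p)` holds at all but countably many fibres, granted Verdier -/

/-- **The rational classes of `Hᵏ(𝒳(ℂ); ℂ)` form a countable set** for `𝒳` smooth projective: they are the image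
of the finite-dimensional `ℚ`-vector space `Hᵏ(𝒳(ℂ); ℚ)` (`isRationalClass_iff_mem_range_ofRatClass`,
`finite_singularCohomology_rat_complexPoints`), and a finite module over a countable ring is countable.
[cite: VoisinHodgeI2002, §7.1.1] [cite: HatcherAT2002, §3.1 p. 198] -/
theorem countable_setOf_isRationalClass {n : ℕ} (h𝒳 : IsSmoothProjective n 𝒳) (k : ℕ) :
    {W : complexBetti 𝒳 k | IsRationalClass W}.Countable := by
  haveI : Module.Finite ℚ (Literature.AlgebraicTopology.SingularHomology.singularCohomology ℚ ℚ (ComplexPoints 𝒳) k) :=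
    finite_singularCohomology_rat_complexPoints h𝒳 k
  haveI : Countable (Literature.AlgebraicTopology.SingularHomology.singularCohomology ℚ ℚ (ComplexPoints 𝒳) k) :=
    Finsupp.Countable.of_moduleFinite (R := ℚ)
  have h : {W : complexBetti 𝒳 k | IsRationalClass W} = Set.range (ofRatClass (ComplexPoints 𝒳) k) := by
    ext W
    exact isRationalClass_iff_mem_range_ofRatClass W
  rw [h]
  exact Set.countable_range _

/-- **THE LIFT HOLDS AT ALL BUT COUNTABLY MANY FIBRES, GRANTED VERDIER.** Let `S` be a smooth projective curve,
`𝒳` smooth projective of dimension `d + 1` and `f : 𝒳 ⟶ S` a smooth projective family of relative dimension `d`.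
There is a COUNTABLE set `E ⊆ S(ℂ)` such that for every `t ∉ E` and EVERY `p`,
`(j_t^*)⁻¹ Nᵖ(𝒳_t) ≤ Nᵖ(𝒳) ⊔ ker j_t^*` — every class of the total space that is algebraic on `𝒳_t` agrees on `𝒳_t`
with an ALGEBRAIC class of the total space. `E` is the union of the countable algebraicity loci of the (countably
many, `countable_setOf_isRationalClass`) rational classes of `𝒳` whose locus is countable; off `E`, a rational class
algebraic on `𝒳_t` has an uncountable locus, so (§2, fact-free) is algebraic on every fibre and (§3, Verdier) lifts;
a general class algebraic on `𝒳_t` is a combination of rational ones (part XVII-b,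
`comap_complexBetti_map_le_span_isRationalClass`). [cite: Verdier1976, Cor. (5.1)]
[cite: CharlesSchnell2014Notes, Prop. 11.3.11 (proof)] [cite: VoisinHodgeII2003, §3.3.1 and §10.2.1 (proof of Thm. 10.19)]
[cite: GrothendieckTopology1969, §1 pp. 299–300] -/
theorem exists_countable_forall_comap_le_sup_of_verdier (hGT : Verdier1976_genericLocalTriviality) {d : ℕ}
    {f : 𝒳 ⟶ S} (hS : IsSmoothProjective 1 S) (h𝒳 : IsSmoothProjective (d + 1) 𝒳)
    (hf : IsSmoothProjectiveFamily f d) :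
    ∃ E : Set (ComplexPoints S), E.Countable ∧ ∀ t ∉ E, ∀ p : ℕ,
      (algebraicClasses (fiberOver f t) p).comap (complexBetti.map (fiberι f t) (2 * p)).hom ≤
        algebraicClasses 𝒳 p ⊔ LinearMap.ker (complexBetti.map (fiberι f t) (2 * p)).hom := by
  have h𝒳qp : IsQuasiProjectiveOver 𝒳 := IsQuasiProjectiveOver.of_isProjectiveOver h𝒳.isProjectiveOver
  -- the exceptional set: the countable loci of the rational classes that have one
  refine ⟨⋃ p : ℕ, ⋃ W ∈ {W : complexBetti 𝒳 (2 * p) | IsRationalClass W ∧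
      {t : ComplexPoints S | complexBetti.map (fiberι f t) (2 * p) W ∈ algebraicClasses (fiberOver f t) p}.Countable},
      {t : ComplexPoints S | complexBetti.map (fiberι f t) (2 * p) W ∈ algebraicClasses (fiberOver f t) p}, ?_, ?_⟩
  · refine Set.countable_iUnion fun p ↦ Set.Countable.biUnion ?_ fun W hW ↦ hW.2
    exact (countable_setOf_isRationalClass h𝒳 (2 * p)).mono fun W hW ↦ hW.1
  · intro t ht p W hW
    have hW' : complexBetti.map (fiberι f t) (2 * p) W ∈ algebraicClasses (fiberOver f t) p := hW
    have hspan := comap_complexBetti_map_le_span_isRationalClass h𝒳 (fiberι f t)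
      (algebraicClasses (fiberOver f t) p)
      (supportedClasses_le_span_isRationalClass (hf.isSmoothProjective t) (2 * p) p) hW'
    refine (Submodule.span_le (p := algebraicClasses 𝒳 p ⊔
      LinearMap.ker (complexBetti.map (fiberι f t) (2 * p)).hom)).2 ?_ hspan
    rintro W' ⟨hW'rat, hW'alg⟩
    rcases algebraicityLocus_countable_or_forall hS h𝒳qp hf W' with hc | hall
    · -- `W'` would be sporadic at `t`, and `t ∈ E`
      exact absurd (Set.mem_iUnion.2 ⟨p, Set.mem_biUnion (show W' ∈ {W : complexBetti 𝒳 (2 * p) |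
        IsRationalClass W ∧ {t : ComplexPoints S | complexBetti.map (fiberι f t) (2 * p) W ∈
          algebraicClasses (fiberOver f t) p}.Countable} from ⟨hW'rat, hc⟩) hW'alg⟩) ht
    · obtain ⟨η, hη, hηW'⟩ := exists_algebraic_lift_of_verdier hGT hS h𝒳 hf W' hall
      change W' ∈ algebraicClasses 𝒳 p ⊔ LinearMap.ker (complexBetti.map (fiberι f t) (2 * p)).hom
      rw [show W' = η + (W' - η) by abel]
      refine Submodule.add_mem_sup hη ?_
      rw [LinearMap.mem_ker, map_sub, sub_eq_zero]
      exact (hηW' t).symm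

/-- **On a compact pencil of abelian varieties, the lift `(L)_t(p)` holds for all `t` outside a countable set,
in every degree, granted Verdier.** So the André-axis `B_min` — `(L)_t(p)` at the CM points — concerns countably
many fibres of each pencil, and fails only where a CM point meets this countable exceptional set.
[cite: Verdier1976, Cor. (5.1)] [cite: CharlesSchnell2014Notes, Prop. 11.3.11 (proof)] [cite: Andre1996Motifs, §6.3 a) (p. 33)] -/
theorem exists_countable_forall_comap_le_sup_of_verdier' (hGT : Verdier1976_genericLocalTriviality) {d : ℕ}
    {f : 𝒳 ⟶ S} (hf : IsCompactAbelianPencil f d) :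
    ∃ E : Set (ComplexPoints S), E.Countable ∧ ∀ t ∉ E, ∀ p : ℕ,
      (algebraicClasses (fiberOver f t) p).comap (complexBetti.map (fiberι f t) (2 * p)).hom ≤
        algebraicClasses 𝒳 p ⊔ LinearMap.ker (complexBetti.map (fiberι f t) (2 * p)).hom :=
  exists_countable_forall_comap_le_sup_of_verdier hGT hf.isSmoothProjective_base hf.isSmoothProjective_total
    hf.isSmoothProjectiveFamily

/-- The lattice identity off the exceptional set: `(j_t^*)⁻¹ Nᵖ(𝒳_t) = Nᵖ(𝒳) ⊔ ker j_t^*` for all `t` outside a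
countable subset of `S(ℂ)` and all `p` (the inclusion `≥` is part XVII-b's unconditional
`algebraicClasses_sup_ker_le_comap`). [cite: Verdier1976, Cor. (5.1)] [cite: Milne2020HodgeClassesAV, Prop. 1 (p. 7)] -/
theorem exists_countable_forall_comap_eq_sup_of_verdier (hGT : Verdier1976_genericLocalTriviality) {d : ℕ}
    {f : 𝒳 ⟶ S} (hf : IsCompactAbelianPencil f d) :
    ∃ E : Set (ComplexPoints S), E.Countable ∧ ∀ t ∉ E, ∀ p : ℕ,
      (algebraicClasses (fiberOver f t) p).comap (complexBetti.map (fiberι f t) (2 * p)).hom =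
        algebraicClasses 𝒳 p ⊔ LinearMap.ker (complexBetti.map (fiberι f t) (2 * p)).hom := by
  obtain ⟨E, hE, h⟩ := exists_countable_forall_comap_le_sup_of_verdier' hGT hf
  exact ⟨E, hE, fun t ht p ↦ le_antisymm (h t ht p) (algebraicClasses_sup_ker_le_comap hf p t)⟩

/-! ## §5 Pointwise exactness: `(L)_t(p)` says that no class is sporadic at `t` -/

/-- **`(L)_t(p)` transports algebraicity out of `𝒳_t` (fact-free)**: on a smooth projective family over a smooth
projective curve, if `(j_t^*)⁻¹ Nᵖ(𝒳_t) ≤ Nᵖ(𝒳) ⊔ ker j_t^*` then every class `W` of the total space algebraic on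
`𝒳_t` is algebraic on EVERY fibre: `W = η + κ` with `η` algebraic (restrictions algebraic: the tree's
`map_fiberι_mem_algebraicClasses`) and `κ|_{𝒳_t} = 0`, whence `κ|_{𝒳_s} = 0` (flat sections, `Andre1996_deformation_hflat`).
[cite: Andre1996Motifs, §5.1 (A4) (p. 25)] [cite: Fulton1998, §10.1 Cor. 10.1 and §19.2 Cor. 19.2 (b)] -/
theorem forall_mem_algebraicClasses_of_comap_le_sup (hS : IsSmoothProjective 1 S) {d : ℕ} {f : 𝒳 ⟶ S}
    (hf : IsSmoothProjectiveFamily f d) {p : ℕ} {t : ComplexPoints S}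
    (hL : (algebraicClasses (fiberOver f t) p).comap (complexBetti.map (fiberι f t) (2 * p)).hom ≤
      algebraicClasses 𝒳 p ⊔ LinearMap.ker (complexBetti.map (fiberι f t) (2 * p)).hom)
    {W : complexBetti 𝒳 (2 * p)} (hW : complexBetti.map (fiberι f t) (2 * p) W ∈ algebraicClasses (fiberOver f t) p)
    (s : ComplexPoints S) : complexBetti.map (fiberι f s) (2 * p) W ∈ algebraicClasses (fiberOver f s) p := by
  haveI : SmoothOfRelativeDimension 1 S.hom := hS.smoothOfRelativeDimension
  haveI hSsm : Smooth S.hom := SmoothOfRelativeDimension.smooth 1 S.hom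
  haveI : IrreducibleSpace S.left := hS.irreducibleSpace
  have hSqp : IsQuasiProjectiveOver S := IsQuasiProjectiveOver.of_isProjectiveOver hS.isProjectiveOver
  have hconn : ConnectedSpace (ComplexPoints S) := connectedSpace_complexPoints hS
  obtain ⟨η, hη, κ, hκ, hWeq⟩ := Submodule.mem_sup.1 (hL hW)
  rw [LinearMap.mem_ker] at hκ
  have hκs : complexBetti.map (fiberι f s) (2 * p) κ = 0 :=
    Andre1996_deformation_hflat f hf hSsm hSqp hconn (2 * p) κ t s hκ
  rw [← hWeq, map_add, hκs, add_zero]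
  exact map_fiberι_mem_algebraicClasses f hf hSqp hη s

/-- **POINTWISE EXACTNESS, transport form** (granted Verdier for ⟸): `(L)_t(p)` ⟺ every class of the total
space algebraic on `𝒳_t` is algebraic on every fibre. [cite: Verdier1976, Cor. (5.1)]
[cite: Andre1996Motifs, §5.1 (A3)–(A4) (p. 25) and §6.3 a) (p. 33)] -/
theorem comap_le_sup_iff_forall_transport_of_verdier (hGT : Verdier1976_genericLocalTriviality) {d : ℕ}
    {f : 𝒳 ⟶ S} (hS : IsSmoothProjective 1 S) (h𝒳 : IsSmoothProjective (d + 1) 𝒳)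
    (hf : IsSmoothProjectiveFamily f d) (p : ℕ) (t : ComplexPoints S) :
    (algebraicClasses (fiberOver f t) p).comap (complexBetti.map (fiberι f t) (2 * p)).hom ≤
        algebraicClasses 𝒳 p ⊔ LinearMap.ker (complexBetti.map (fiberι f t) (2 * p)).hom ↔
      ∀ W : complexBetti 𝒳 (2 * p),
        complexBetti.map (fiberι f t) (2 * p) W ∈ algebraicClasses (fiberOver f t) p →
        ∀ s : ComplexPoints S, complexBetti.map (fiberι f s) (2 * p) W ∈ algebraicClasses (fiberOver f s) p := by
  refine ⟨fun hL W hW s ↦ forall_mem_algebraicClasses_of_comap_le_sup hS hf hL hW s, fun h W hW ↦ ?_⟩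
  obtain ⟨η, hη, hηW⟩ := exists_algebraic_lift_of_verdier hGT hS h𝒳 hf W (h W hW)
  change W ∈ algebraicClasses 𝒳 p ⊔ LinearMap.ker (complexBetti.map (fiberι f t) (2 * p)).hom
  rw [show W = η + (W - η) by abel]
  refine Submodule.add_mem_sup hη ?_
  rw [LinearMap.mem_ker, map_sub, sub_eq_zero]
  exact (hηW t).symm

/-- **POINTWISE EXACTNESS, countability form: `(L)_t(p)` ⟺ NO CLASS IS SPORADIC AT `t`** — every class of the
total space algebraic on `𝒳_t` is algebraic on UNCOUNTABLY many fibres (⟹ fact-free via §2; ⟸ granted Verdier).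
[cite: Verdier1976, Cor. (5.1)] [cite: CharlesSchnell2014Notes, Prop. 11.3.11 (proof)] -/
theorem comap_le_sup_iff_forall_not_countable_of_verdier (hGT : Verdier1976_genericLocalTriviality) {d : ℕ}
    {f : 𝒳 ⟶ S} (hS : IsSmoothProjective 1 S) (h𝒳 : IsSmoothProjective (d + 1) 𝒳)
    (hf : IsSmoothProjectiveFamily f d) (p : ℕ) (t : ComplexPoints S) :
    (algebraicClasses (fiberOver f t) p).comap (complexBetti.map (fiberι f t) (2 * p)).hom ≤
        algebraicClasses 𝒳 p ⊔ LinearMap.ker (complexBetti.map (fiberι f t) (2 * p)).hom ↔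
      ∀ W : complexBetti 𝒳 (2 * p),
        complexBetti.map (fiberι f t) (2 * p) W ∈ algebraicClasses (fiberOver f t) p →
        ¬ {s : ComplexPoints S |
          complexBetti.map (fiberι f s) (2 * p) W ∈ algebraicClasses (fiberOver f s) p}.Countable := by
  rw [comap_le_sup_iff_forall_transport_of_verdier hGT hS h𝒳 hf p t]
  have h𝒳qp : IsQuasiProjectiveOver 𝒳 := IsQuasiProjectiveOver.of_isProjectiveOver h𝒳.isProjectiveOver
  exact forall_congr' fun W ↦ imp_congr_right fun _ ↦
    (not_countable_algebraicityLocus_iff_forall hS h𝒳qp hf W t).symm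

/-- The same on a compact pencil of abelian varieties: **the André-axis `B_min` at a point `t` ⟺ no class of the
`(d+1)`-fold is sporadic at `t`.** [cite: Verdier1976, Cor. (5.1)] [cite: Andre1996Motifs, §6.3 a) (p. 33)] -/
theorem comap_le_sup_iff_forall_not_countable_of_verdier' (hGT : Verdier1976_genericLocalTriviality) {d : ℕ}
    {f : 𝒳 ⟶ S} (hf : IsCompactAbelianPencil f d) (p : ℕ) (t : ComplexPoints S) :
    (algebraicClasses (fiberOver f t) p).comap (complexBetti.map (fiberι f t) (2 * p)).hom ≤
        algebraicClasses 𝒳 p ⊔ LinearMap.ker (complexBetti.map (fiberι f t) (2 * p)).hom ↔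
      ∀ W : complexBetti 𝒳 (2 * p),
        complexBetti.map (fiberι f t) (2 * p) W ∈ algebraicClasses (fiberOver f t) p →
        ¬ {s : ComplexPoints S |
          complexBetti.map (fiberι f s) (2 * p) W ∈ algebraicClasses (fiberOver f s) p}.Countable :=
  comap_le_sup_iff_forall_not_countable_of_verdier hGT hf.isSmoothProjective_base hf.isSmoothProjective_total
    hf.isSmoothProjectiveFamily p t

end Summit.HodgeConjecture.HodgeConjecture.Ring2.AbelianAll

end
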